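import Mathlib
import Summits.NavierStokesRegularity.NavierStokesRegularity.Theses.QuarterTurnRdss
import HarnessLib

/-!
# `QuarterTurnRdss.QuarterTurnRdssIsDss4` — a quarter-turn rotated-DSS field is `c⁴`-DSS
  (route `QuarterTurnRdss`, item stmt-NavierStokesRegularity-1103, support; bookkeeping)

Bradshaw–Tsai 2017, §1 (arXiv:1610.05680 p. 3: "if `nφ = 2πm` then `v` is DSS with factor `λⁿ`"),
case `n = 4`: a `(c, R)`-rotated discretely self-similar field with `R` the quarter turn about the
`x₃`-axis (`(Rx)₀ = −x₁`, `(Rx)₁ = x₀`, `(Rx)₂ = x₂`, so `R⁴ = id`) is discretely self-similar with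
factor `c⁴`: iterate the law `c R⁻¹ u(c²t, cRx) = u(t,x)` four times (group law of rotated discrete
self-similarity, as in `CorkscrewDynamoCorkscrewProfileRdssIterate`), and `R⁴ = 1` by the coordinate
description.

HONEST FRAMING: elementary bookkeeping about a HYPOTHETICAL profile; nothing here bears on the
regularity problem itself.
-/

noncomputable section

set_option linter.dupNamespace false

namespace Summit.NavierStokesRegularity.NavierStokesRegularity.Theorems

open Literature.Analysis Literature.Analysis.FluidPDE

/-- **Item stmt-NavierStokesRegularity-1103** (`QuarterTurnRdss.QuarterTurnRdssIsDss4`; Bradshaw–Tsai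
2017 §1): `(c, R)`-RDSS with `R` the quarter turn about `e₃` ⇒ `c⁴`-DSS. [this file; BradshawTsai2017CPDE §1] -/
theorem quarterTurnRdss_quarterTurnRdssIsDss4_proof :
    Summit.NavierStokesRegularity.NavierStokesRegularity.Theses.QuarterTurnRdss.QuarterTurnRdssIsDss4 := by
  unfold Summit.NavierStokesRegularity.NavierStokesRegularity.Theses.QuarterTurnRdss.QuarterTurnRdssIsDss4
  intro c R u _hc hR h
  -- group law of rotated discrete self-similarity (cf. `IsRotatedDSS.trans_mul`)
  have key : ∀ {a b : ℝ} {S S' : EuclideanSpace ℝ (Fin 3) ≃ₗᵢ[ℝ] EuclideanSpace ℝ (Fin 3)},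
      IsRotatedDSS a S u → IsRotatedDSS b S' u → IsRotatedDSS (a * b) (S.trans S') u := by
    intro a b S S' ha hb t x
    have e1 : (a * b) ^ 2 * t = b ^ 2 * (a ^ 2 * t) := by ring
    have e2 : (a * b) • (S.trans S') x = b • S' (a • S x) := by
      rw [LinearIsometryEquiv.trans_apply, map_smul, smul_smul, mul_comm]
    rw [e1, e2, ← ha t x, ← hb (a ^ 2 * t) (a • S x)]
    simp only [LinearIsometryEquiv.symm_trans, LinearIsometryEquiv.trans_apply, map_smul, smul_smul]
  -- four iterations
  have h4 : IsRotatedDSS (c * c * c * c) (((R.trans R).trans R).trans R) u := key (key (key h h) h) h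
  -- `R⁴ = 1` from the coordinate description of the quarter turn
  have hR4 : ((R.trans R).trans R).trans R = LinearIsometryEquiv.refl ℝ (EuclideanSpace ℝ (Fin 3)) := by
    refine LinearIsometryEquiv.ext fun x => ?_
    simp only [LinearIsometryEquiv.trans_apply, LinearIsometryEquiv.coe_refl, id]
    obtain ⟨a0, a1, a2⟩ := hR x
    obtain ⟨b0, b1, b2⟩ := hR (R x)
    obtain ⟨c0, c1, c2⟩ := hR (R (R x))
    obtain ⟨d0, d1, d2⟩ := hR (R (R (R x)))
    ext i
    fin_cases i
    · show (R (R (R (R x)))) 0 = x 0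
      rw [d0, c1, b0, a1, neg_neg]
    · show (R (R (R (R x)))) 1 = x 1
      rw [d1, c0, b1, a0, neg_neg]
    · show (R (R (R (R x)))) 2 = x 2
      rw [d2, c2, b2, a2]
  rw [hR4, show c * c * c * c = c ^ 4 by ring] at h4
  exact isRotatedDSS_refl_iff.1 h4

end Summit.NavierStokesRegularity.NavierStokesRegularity.Theorems

end
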